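import Summits.KontsevichZagierPeriods.KontsevichZagierPeriods.Theorems.HurwitzMicroSectorsNormalFormPrincipleSplitMoves

/-!
# `NormalFormPrinciple` (stmt-KontsevichZagierPeriods-3869), line `SketchIdeator1` — leaf
# `stub_boxRigidity`, algebraic-pole layer: the registered sub-goal `nfA_pole_one`

Pure proof file (`--supports` the crux stmt-KontsevichZagierPeriods-3869; siege attempt k8,
variation "certificate on the finite core"). The registered sub-goal `nfA_pole_one` of the
algebraic-pole layer of the leaf: a simple pole with real ALGEBRAIC position `ρ ∉ [0,1]` and real
algebraic residue `c` on the open unit slab,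
  `T = [(0,1), c/(x − ρ)]`,
is, modulo the Kontsevich–Zagier relations, in the algebraic normal form
"rational point + carriers":
  `[T] = [pt, r] + Σⱼ [(1, uⱼ), cⱼ/y]`, with `r, uⱼ, cⱼ` real algebraic and `uⱼ > 1`.

The certificate is finite and explicit — `r = 0` and ONE carrier (`k = 1`), reached by ONE affine
change of variables (rule 2) `x = Φ(y) = s·y + ρ` from the carrier slab `(1, u)` onto `(0,1)`:
* `ρ < 0`: `s = −ρ > 0`, `u = (ρ − 1)/ρ = 1 + 1/(−ρ) > 1`, `c₀ = c`;
* `1 < ρ`: `s = 1 − ρ < 0`, `u = ρ/(ρ − 1) > 1`, `c₀ = −c`;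
in both cases `c/(Φ(y) − ρ)·|s| = c·|s|/(s·y) = c₀/y` on `(1,u)`, and `[pt, 0]` is a relation
(zero integrand). The affine chart lemmas are those of
`…TerasomaMultiplicationBetaCancellationStubAffineMove.lean`, the slab images those of
`…HurwitzMicroSectorsNormalFormPrincipleSplitMoves.lean`.

Sources: M. Kontsevich, D. Zagier, *Periods* (2001), §1.2 rules (1), (2). No definitions are
introduced.
-/

noncomputable section

open MeasureTheory Set
open Literature.NumberTheory.Transcendental Literature.NumberTheory.Transcendental.KZ

namespace Summit.KontsevichZagierPeriods.HurwitzMicroSectors.NormalFormPrinciple.PiBox.Dlog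

namespace AlgPoleK8

open Summit.KontsevichZagierPeriods.KontsevichZagierPeriods.BetaCancellationLine
  (aff_hasFDerivAt_chart aff_injective_chart aff_isSemialgebraicMapOn_chart)

/-- **Affine move with real algebraic coefficients** (rule 2), either orientation: if
`Φ(y) = s·y + t` (`s ≠ 0`; `s, t` real algebraic) maps `L.domain ⊆ ℝ¹` onto `T.domain` and
`L.integrand = (T.integrand ∘ Φ)·|s|` on `L.domain`, then `[L] − [T] ∈ relations`
(Jacobian `|det (s • id_{ℝ¹})| = |s|`). [cite: KontsevichZagier2001, §1.2 rule (2)] -/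
theorem affineA_sub_mem_relations {s t : ℝ} (hs : IsAlgebraic ℚ s) (ht : IsAlgebraic ℚ t)
    (hs0 : s ≠ 0) (L T : IntegralRep 1)
    (himage : T.domain = (fun y : Fin 1 → ℝ => fun _ : Fin 1 => s * y 0 + t) '' L.domain)
    (hint : ∀ x ∈ L.domain,
      L.integrand x = T.integrand (fun _ : Fin 1 => s * x 0 + t) * |s|) :
    of L - of T ∈ relations := by
  have hdet : |(s • ContinuousLinearMap.id ℝ (Fin 1 → ℝ)).det| = |s| := by
    have : (s • ContinuousLinearMap.id ℝ (Fin 1 → ℝ)).det = s := by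
      change LinearMap.det ((s • ContinuousLinearMap.id ℝ (Fin 1 → ℝ) :
        (Fin 1 → ℝ) →L[ℝ] (Fin 1 → ℝ)) : (Fin 1 → ℝ) →ₗ[ℝ] (Fin 1 → ℝ)) = s
      rw [ContinuousLinearMap.toLinearMap_smul, ContinuousLinearMap.coe_id,
        LinearMap.det_smul, LinearMap.det_id, Module.finrank_fin_fun]
      ring
    rw [this]
  refine changeOfVariablesRel_subset_relations
    ⟨1, L, T, fun y : Fin 1 → ℝ => fun _ : Fin 1 => s * y 0 + t,
      fun _ => s • ContinuousLinearMap.id ℝ (Fin 1 → ℝ),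
      aff_isSemialgebraicMapOn_chart L.isSemialgebraic_domain ht hs,
      fun x _ => (aff_hasFDerivAt_chart s t x).hasFDerivWithinAt,
      (aff_injective_chart hs0 t).injOn, himage, fun x hx => ?_, rfl⟩
  rw [hint x hx, hdet]

/-- **Stub `nfA_pole_one`** (registered sub-goal of crux stmt-KontsevichZagierPeriods-3869, line
`SketchIdeator1`, algebraic-pole layer of the leaf `stub_boxRigidity`). A simple pole with real
algebraic position `ρ ∉ [0,1]` and real algebraic residue `c` on the unit slab,
`T = [(0,1), c/(x − ρ)]`, is in algebraic normal form modulo relations: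
`[T] = [pt, r] + Σⱼ [(1,uⱼ), cⱼ/y]` with `r, uⱼ, cⱼ` real algebraic and `uⱼ > 1`.
Certificate: `r = 0`, `k = 1`, `(u₀, c₀) = ((ρ − 1)/ρ, c)` if `ρ < 0` and `(ρ/(ρ − 1), −c)` if
`1 < ρ`, by the single affine move `x = s·y + ρ` (`s = −ρ`, resp. `s = 1 − ρ`); `[pt, 0] ∈ relations`.
[cite: KontsevichZagier2001, §1.2 rules (1), (2)] -/
theorem nfA_pole_one {RA : ℝ → ℝ → ℝ → IntegralRep 1} {ZA : ℝ → IntegralRep 0}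
    (hR : ∀ a b c, IsAlgebraic ℚ a → IsAlgebraic ℚ b → IsAlgebraic ℚ c → 0 < a →
      (RA a b c).domain = {x | x 0 ∈ Set.Ioo a b} ∧ (RA a b c).integrand = fun x => c / x 0)
    (hZ : ∀ r, IsAlgebraic ℚ r → (ZA r).domain = univ ∧ (ZA r).integrand = fun _ => r)
    {c ρ : ℝ} (hc : IsAlgebraic ℚ c) (hρA : IsAlgebraic ℚ ρ) (hρ : ρ ∉ Set.Icc (0:ℝ) 1)
    (T : IntegralRep 1) (hTd : T.domain = {x | x 0 ∈ Set.Ioo (0:ℝ) 1})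
    (hTi : EqOn T.integrand (fun x => c / (x 0 - ρ)) T.domain) :
    ∃ (r : ℝ) (k : ℕ) (u c : Fin k → ℝ), IsAlgebraic ℚ r ∧ (∀ j, 1 < u j) ∧
      (∀ j, IsAlgebraic ℚ (u j)) ∧ (∀ j, IsAlgebraic ℚ (c j)) ∧
      QuotientAddGroup.mk' relations (of T) =
        QuotientAddGroup.mk' relations (of (ZA r)) +
          ∑ j, QuotientAddGroup.mk' relations (of (RA 1 (u j) (c j))) := by
  -- the point term `[pt, 0]` vanishes in the quotient (zero integrand, rule 1)
  have hZ0 : QuotientAddGroup.mk' relations (of (ZA 0)) = 0 := by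
    rw [QuotientAddGroup.mk'_apply, QuotientAddGroup.eq_zero_iff]
    exact of_mem_relations_of_eqOn_zero _ fun x _ => by rw [(hZ 0 isAlgebraic_zero).2]; rfl
  -- it suffices to produce ONE carrier `[(1,u), c₀/y]` equivalent to `T`
  suffices h : ∃ u c₀ : ℝ, 1 < u ∧ IsAlgebraic ℚ u ∧ IsAlgebraic ℚ c₀ ∧
      of (RA 1 u c₀) - of T ∈ relations by
    obtain ⟨u, c₀, hu1, hu, hc₀, hrel⟩ := h
    refine ⟨0, 1, fun _ => u, fun _ => c₀, isAlgebraic_zero, fun _ => hu1, fun _ => hu,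
      fun _ => hc₀, ?_⟩
    rw [hZ0, zero_add, Fin.sum_univ_one, QuotientAddGroup.mk'_apply, QuotientAddGroup.mk'_apply,
      eq_comm, QuotientAddGroup.eq_iff_sub_mem]
    exact hrel
  have hcases : ρ < 0 ∨ 1 < ρ := by
    rcases lt_or_ge ρ 0 with h | h
    · exact Or.inl h
    · exact Or.inr (not_le.mp fun h' => hρ ⟨h, h'⟩)
  rcases hcases with hρ0 | hρ1
  · -- `ρ < 0`: carrier `[(1, (ρ-1)/ρ), c/y]`, chart `x = (−ρ)·y + ρ` (increasing)
    have hρne : ρ ≠ 0 := hρ0.ne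
    have hs0 : 0 < -ρ := neg_pos.mpr hρ0
    have hu1 : 1 < (ρ - 1) / ρ := by
      rw [lt_div_iff_of_neg hρ0]
      linarith
    have hu : IsAlgebraic ℚ ((ρ - 1) / ρ) := by
      rw [div_eq_mul_inv]
      exact (hρA.sub isAlgebraic_one).mul hρA.inv
    obtain ⟨hLd, hLi⟩ := hR 1 ((ρ - 1) / ρ) c isAlgebraic_one hu hc one_pos
    refine ⟨(ρ - 1) / ρ, c, hu1, hu, hc, affineA_sub_mem_relations hρA.neg hρA
      hs0.ne' (RA 1 ((ρ - 1) / ρ) c) T ?_ fun x hx => ?_⟩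
    · rw [hTd, hLd, image_affine_slab_of_pos hs0]
      have h1 : -ρ * 1 + ρ = 0 := by ring
      have h2 : -ρ * ((ρ - 1) / ρ) + ρ = 1 := by field_simp; ring
      rw [h1, h2]
    · have hx1 : 1 < x 0 := by rw [hLd] at hx; exact hx.1
      have hx0 : x 0 ≠ 0 := (lt_trans one_pos hx1).ne'
      have hxu : ρ - 1 < x 0 * ρ := by
        rw [← lt_div_iff_of_neg hρ0]
        rw [hLd] at hx
        exact hx.2
      have hΦx : (fun _ : Fin 1 => -ρ * x 0 + ρ) ∈ T.domain := by
        rw [hTd]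
        simp only [Set.mem_setOf_eq, Set.mem_Ioo]
        constructor <;> nlinarith
      rw [hLi, hTi hΦx, abs_of_pos hs0]
      have hlin : -ρ * x 0 + ρ - ρ = -ρ * x 0 := by ring
      simp only [hlin]
      field_simp
  · -- `1 < ρ`: carrier `[(1, ρ/(ρ-1)), (−c)/y]`, chart `x = (1−ρ)·y + ρ` (decreasing)
    have hρne : ρ - 1 ≠ 0 := (sub_pos.mpr hρ1).ne'
    have hs0 : 1 - ρ < 0 := by linarith
    have hu1 : 1 < ρ / (ρ - 1) := by
      rw [lt_div_iff₀ (sub_pos.mpr hρ1)]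
      linarith
    have hu : IsAlgebraic ℚ (ρ / (ρ - 1)) := by
      rw [div_eq_mul_inv]
      exact hρA.mul (hρA.sub isAlgebraic_one).inv
    obtain ⟨hLd, hLi⟩ := hR 1 (ρ / (ρ - 1)) (-c) isAlgebraic_one hu hc.neg one_pos
    refine ⟨ρ / (ρ - 1), -c, hu1, hu, hc.neg, affineA_sub_mem_relations
      (isAlgebraic_one.sub hρA) hρA hs0.ne (RA 1 (ρ / (ρ - 1)) (-c)) T ?_ fun x hx => ?_⟩
    · rw [hTd, hLd, image_affine_slab_of_neg hs0]
      have h1 : (1 - ρ) * 1 + ρ = 1 := by ring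
      have h2 : (1 - ρ) * (ρ / (ρ - 1)) + ρ = 0 := by field_simp; ring
      rw [h1, h2]
    · have hx1 : 1 < x 0 := by rw [hLd] at hx; exact hx.1
      have hx0 : x 0 ≠ 0 := (lt_trans one_pos hx1).ne'
      have hxu : x 0 < ρ / (ρ - 1) := by rw [hLd] at hx; exact hx.2
      have hΦx : (fun _ : Fin 1 => (1 - ρ) * x 0 + ρ) ∈ T.domain := by
        rw [hTd]
        simp only [Set.mem_setOf_eq, Set.mem_Ioo]
        rw [lt_div_iff₀ (sub_pos.mpr hρ1)] at hxu
        constructor <;> nlinarith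
      rw [hLi, hTi hΦx, abs_of_neg hs0]
      have hs0' : 1 - ρ ≠ 0 := hs0.ne
      have hlin : (1 - ρ) * x 0 + ρ - ρ = (1 - ρ) * x 0 := by ring
      simp only [hlin]
      field_simp

end AlgPoleK8

end Summit.KontsevichZagierPeriods.HurwitzMicroSectors.NormalFormPrinciple.PiBox.Dlog
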